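import Literature.Analysis.FluidPDE.OneComponentSliceEstimate
import Literature.Analysis.FluidPDE.OneDirectionSlabGronwall
import Literature.Analysis.FluidPDE.LerayLocalRegularH1Proofs
import HarnessLib

/-!
# One-component regularity: Grönwall on a Tao slab (Lemarié-Rieusset 2016, §11.5, proof of Prop. 11.5, (11.28)–(11.30))

Analysis/FluidPDE proof file (theorems only: no definition, no named fact, no `sorry`).
Search for candidate a priori estimates; no regularity claim (cell `pub-nsfunc`, literature seat:
this file formalises a PUBLISHED computation; nothing new). Sixth brick of the discharge of the
named fact `Literature.Analysis.FluidPDE.oneComponentGradientCriterion`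
(`GradientRegularityCriteria.lean`; P. G. Lemarié-Rieusset, *The Navier–Stokes Problem in the
21st Century* (2016), §11.5 Prop. 11.5, PDF pp. 354–357). On a slab `[0, T] × ℝ³` carrying a
classical solution in Tao's `L²`-Sobolev class, the balances of `E(t) = ∫|∇u(t)|²_F`
(`IsSmoothSpaceTimeOn.enstrophy_balance`) and of `G(t) = ‖ω₃(t)‖₂²` (`IsSmoothSpaceTimeOn.lTheta_balance`
with `θ = 2` for the field `ω₃e₃`, `∂ₜω = curl ∂ₜu`), the chain rule for `G²`, the slice estimate
`oneComponent_slice_le` at almost every time and Grönwall's lemma (`lintegral_gronwall_le`) give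
`1 + E(s) + G(s)² ≤ exp(C ∫₀ˢ (1 + ‖∇u₃‖_r^q + E)) (1 + E(0) + G(0)²)`, `q = 4r/(3r-6)` — a
VARIANT of the book's (11.28)–(11.30) followed by "Thus, we get again that
`sup_{t<T₀} ‖u‖_{Ḣ¹} < +∞`".

Deviations from print (disclosure; cell `pub-nsfunc` referee findings F50.2, F50.3, F49.2). (i) The
book propagates `K = I + λJ` with `I = ½‖∇⊗u‖₂²`, `J = 1 + (∫ω₃²)²/4`, `λ = 4C₁N₀²/ν⁴`, and Grönwall
weights `‖∇u₃‖_{X_{r₀}}^{p₀}` and `‖∇u₃‖_r^{2r/(2r−3)}‖u‖_{Ḣ¹}^{r/(2r−3)}` (PDF pp. 355–357); this file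
takes `λ = 1` (functional `1 + E + G²`, `E = 2I`, `G² = 4(J − 1)`) and puts the enstrophy itself into
the weight, `C(1 + ‖∇u₃‖_r^q + ‖∇u‖₂²)`, which is time-integrable for a Leray–Hopf solution by the
energy inequality (11.26) — same conclusion shape (`sup_{t<T₀}‖u‖_{Ḣ¹} < ∞`), non-sharp constants.
(ii) Print typo: the third bullet of PDF p. 357 reads "with `p = 4r/(3r−2)`"; the Hölder pair
`(2r/(2r−3), r/(2(2r−3)))` used there forces `p = 4r/(3r−6)`, the exponent of `2/p + 3/r = 3/2`,
which is the `q` of this file. (iii) At the endpoint `r = 6` (`p = 2`) the book switches to the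
Lorentz space `X_{r₀} = L^{3,1}` (PDF p. 356); the slice estimate imported here
(`OneComponentSliceEstimate`) instead Hölders the Hessian term at `σ = 6` exactly, where the Agmon
factor has exponent `(σ−6)/σ = 0` and only `‖u‖₆ ≤ K‖∇u‖₂` enters — valid uniformly for
`r ∈ (2, 6]` through the `‖∇u‖₂²`-in-the-weight device of (i), again non-sharp.

* `oneComponent_functional_le_mul_exp` — the Grönwall inequality on a slab.

## References

* [LemarieRieusset2016] P. G. Lemarié-Rieusset, *The Navier–Stokes Problem in the 21st Century*,
  CRC Press 2016, §11.5, proof of Prop. 11.5, (11.28)–(11.30) (held text, PDF pp. 355–356).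
-/

noncomputable section

open MeasureTheory Set Function Filter Topology InnerProductSpace
open Literature.Analysis.FunctionSpaces
open scoped ENNReal NNReal ContDiff RealInnerProductSpace Laplacian

namespace Literature.Analysis.FluidPDE

/-! ### The chain rule for the square of an absolutely continuous function -/

section Square

/-- **`J(b)² = J(0)² + ∫₀ᵇ 2 J J'`** for `J` continuous on `[0, T]` with `J(b) = J(0) + ∫₀ᵇ φ`,
`φ ∈ L¹(0, T)` (absolute continuity and the fundamental theorem of calculus); the density `2Jφ`
is integrable. [folklore] -/
private theorem sq_eq_add_integral_ocg {J φ : ℝ → ℝ} {T : ℝ}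
    (hJc : ContinuousOn J (Icc 0 T)) (hφ : IntegrableOn φ (Ioo 0 T) volume)
    (hJ : ∀ b ∈ Ioc 0 T, J b = J 0 + ∫ t in (0 : ℝ)..b, φ t) :
    IntegrableOn (fun t => 2 * J t * φ t) (Ioo 0 T) volume ∧
    ∀ b ∈ Ioc 0 T, J b ^ 2 = J 0 ^ 2 + ∫ t in (0 : ℝ)..b, 2 * J t * φ t := by
  obtain ⟨M, hM⟩ := IsCompact.exists_bound_of_continuousOn isCompact_Icc hJc
  have hint : IntegrableOn (fun t => 2 * J t * φ t) (Ioo 0 T) volume := by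
    have hmeas : AEStronglyMeasurable (fun t => 2 * J t) (volume.restrict (Ioo 0 T)) :=
      ((continuousOn_const.mul hJc).mono Ioo_subset_Icc_self).aestronglyMeasurable
        measurableSet_Ioo
    refine Integrable.bdd_mul (c := 2 * M) hφ hmeas ?_
    refine (ae_restrict_iff' measurableSet_Ioo).2 (Eventually.of_forall fun t ht => ?_)
    have h := hM t (Ioo_subset_Icc_self ht)
    rw [norm_mul, Real.norm_eq_abs, abs_of_pos (by norm_num : (0:ℝ) < 2)]
    exact mul_le_mul_of_nonneg_left h (by norm_num)
  refine ⟨hint, fun b hb => ?_⟩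
  have hφb : IntervalIntegrable φ volume 0 b := by
    rw [intervalIntegrable_iff, uIoc_of_le hb.1.le, integrableOn_Ioc_iff_integrableOn_Ioo]
    exact hφ.mono_set (Ioo_subset_Ioo le_rfl hb.2)
  set Jl : ℝ → ℝ := fun t => J 0 + ∫ τ in (0 : ℝ)..t, φ τ with hJl
  have hJl_eq : ∀ t ∈ Icc 0 b, Jl t = J t := by
    intro t ht
    rcases eq_or_lt_of_le ht.1 with h0 | h0
    · rw [hJl, ← h0]; simp
    · rw [hJl]; simp only; rw [hJ t ⟨h0, ht.2.trans hb.2⟩]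
  have hAC : AbsolutelyContinuousOnInterval Jl 0 b := by
    have h1 := hφb.absolutelyContinuousOnInterval_intervalIntegral (c := 0) (by simp)
    have h2 : AbsolutelyContinuousOnInterval (fun _ : ℝ => J 0) 0 b :=
      contDiffOn_const.absolutelyContinuousOnInterval
    exact h2.fun_add h1
  have hAC2 : AbsolutelyContinuousOnInterval (fun t => Jl t ^ 2) 0 b := by
    have h := hAC.fun_mul hAC
    have e2 : (fun t => Jl t ^ 2) = fun t => Jl t * Jl t := funext fun t => by ring
    rw [e2]; exact h
  have hFTC := hAC2.integral_deriv_eq_sub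
  have hder : ∀ᵐ x ∂volume, x ∈ uIoc (0 : ℝ) b → deriv (fun t => Jl t ^ 2) x = 2 * J x * φ x := by
    filter_upwards [hφb.ae_hasDerivAt_integral] with x hx hxI
    have hxI' : x ∈ uIcc 0 b := uIoc_subset_uIcc hxI
    have hxIcc : x ∈ Icc 0 b := by
      rw [uIoc_of_le hb.1.le] at hxI; exact ⟨hxI.1.le, hxI.2⟩
    have h1 : HasDerivAt (fun t => ∫ τ in (0 : ℝ)..t, φ τ) (φ x) x := hx hxI' 0 (by simp)
    have h2 : HasDerivAt Jl (φ x) x := by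
      have := h1.const_add (J 0)
      simpa [hJl] using this
    have h3 : HasDerivAt (fun t => Jl t ^ 2) (2 * Jl x * φ x) x :=
      (h2.fun_pow 2).congr_deriv (by norm_num)
    rw [h3.deriv, hJl_eq x hxIcc]
  have hI : ∫ x in (0 : ℝ)..b, deriv (fun t => Jl t ^ 2) x = ∫ x in (0 : ℝ)..b, 2 * J x * φ x :=
    intervalIntegral.integral_congr_ae hder
  rw [← hI, hFTC, hJl_eq b ⟨hb.1.le, le_rfl⟩, hJl_eq 0 ⟨le_rfl, hb.1.le⟩]
  ring

end Square

/-! ### Grönwall on a Tao slab -/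

section Gronwall

/-- **The one-component functional on a Tao slab obeys Grönwall's inequality**
(Lemarié-Rieusset 2016, proof of Prop. 11.5, (11.28)–(11.30): the differential inequalities for
`‖u‖²_{Ḣ¹}` and `‖ω₃‖₂²`, followed by "we get again that `sup_{t<T₀} ‖u‖_{Ḣ¹} < +∞`"). Let
`ν > 0`, `2 < r ≤ 6`; there is `C ≥ 0` such that: for every classical solution `(u, p)` of the
unforced Navier–Stokes equations on `[0, T] × ℝ³` in Tao's `L²`-Sobolev class and every
`s ∈ (0, T]` such that `∇u₃(t) ∈ L^r` for a.e. `t ∈ (0, s)` and the weight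
`∫₀ˢ (1 + ‖∇u₃(t)‖_r^q + ∫|∇u(t)|²_F) dt` is finite (`q = 4r/(3r-6)`), the functional
`1 + ∫|∇u|²_F + (∫ω₃²)²` satisfies
`(1 + E + G²)(s) ≤ exp(C ∫₀ˢ (1 + ‖∇u₃‖_r^q + E)) (1 + E + G²)(0)`.
[cite: LemarieRieusset2016, §11.5 Prop. 11.5 proof, (11.28)–(11.30) (PDF pp. 355–356)] -/
theorem oneComponent_functional_le_mul_exp {ν : ℝ} (hν : 0 < ν) {r : ℝ} (hr2 : 2 < r) (hr6 : r ≤ 6) :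
    ∃ C : ℝ, 0 ≤ C ∧ ∀ (T : ℝ) (u : ℝ → EuclideanSpace ℝ (Fin 3) → EuclideanSpace ℝ (Fin 3))
      (p : ℝ → EuclideanSpace ℝ (Fin 3) → ℝ) (s : ℝ), 0 < T →
      FluidPDE.IsClassicalNSSolutionOn (Icc 0 T) ν 0 u p →
      HasBoundedSobolevNormsOn (Icc 0 T) u →
      HasBoundedSobolevNormsOn (Icc 0 T) (FluidPDE.timeDerivWithin (Icc 0 T) u) →
      (∀ n : ℕ, ∃ C' : ℝ≥0, ∀ t ∈ Icc 0 T, ∫⁻ x, ‖iteratedFDeriv ℝ n (p t) x‖ₑ ^ 2 ≤ C') →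
      s ∈ Ioc 0 T →
      (∀ᵐ t ∂volume, t ∈ Ioo 0 s →
        ∫⁻ x, ENNReal.ofReal ‖fderiv ℝ (fun y => u t y 2) x‖ ^ r < ⊤) →
      (∫⁻ t in Ioo 0 s, (1 + ENNReal.ofReal
          (((∫⁻ x, ENNReal.ofReal ‖fderiv ℝ (fun y => u t y 2) x‖ ^ r) ^ (1 / r)).toReal ^
            (4 * r / (3 * r - 6))) +
          ENNReal.ofReal (∫ x, FluidPDE.frobeniusNormSq (fderiv ℝ (u t) x))) ≠ ⊤) →
      1 + (∫ x, FluidPDE.frobeniusNormSq (fderiv ℝ (u s) x)) + (∫ x, (curl (u s) x 2) ^ 2) ^ 2 ≤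
        Real.exp (C * (∫⁻ t in Ioo 0 s, (1 + ENNReal.ofReal
          (((∫⁻ x, ENNReal.ofReal ‖fderiv ℝ (fun y => u t y 2) x‖ ^ r) ^ (1 / r)).toReal ^
            (4 * r / (3 * r - 6))) +
          ENNReal.ofReal (∫ x, FluidPDE.frobeniusNormSq (fderiv ℝ (u t) x)))).toReal) *
        (1 + (∫ x, FluidPDE.frobeniusNormSq (fderiv ℝ (u 0) x)) + (∫ x, (curl (u 0) x 2) ^ 2) ^ 2) := by
  obtain ⟨C, hC0, hsl⟩ := oneComponent_slice_le hν hr2 hr6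
  refine ⟨2 * C, by positivity, ?_⟩
  intro T u p s hT hsol hu hut hp hs hLr hA
  have hU : UniqueDiffOn ℝ (Icc 0 T) := uniqueDiffOn_Icc hT
  have hcl : Icc 0 T ⊆ closure (interior (Icc 0 T)) := by
    rw [interior_Icc, closure_Ioo hT.ne]
  have hsm : FluidPDE.IsSmoothSpaceTimeOn (Icc 0 T) u := hsol.smooth_velocity
  set W : ℝ → EuclideanSpace ℝ (Fin 3) → EuclideanSpace ℝ (Fin 3) :=
    FluidPDE.timeDerivWithin (Icc 0 T) u with hW
  have hWsm : FluidPDE.IsSmoothSpaceTimeOn (Icc 0 T) W := hsm.timeDerivWithin hU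
  set e3 : EuclideanSpace ℝ (Fin 3) := EuclideanSpace.basisFun (Fin 3) ℝ 2 with he3
  have he1 : ‖e3‖ = 1 := by simp [he3]
  have he22 : ⟪e3, e3⟫ = (1 : ℝ) := by rw [real_inner_self_eq_norm_sq, he1]; norm_num
  have hinner : ∀ y : EuclideanSpace ℝ (Fin 3), ⟪e3, y⟫ = y 2 := fun y => by
    simp [he3, EuclideanSpace.inner_single_left]
  -- the vorticity and its third component along `e₃`
  set om : ℝ → EuclideanSpace ℝ (Fin 3) → EuclideanSpace ℝ (Fin 3) := fun t x => curl (u t) x with hom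
  have hom_sm : FluidPDE.IsSmoothSpaceTimeOn (Icc 0 T) om := by
    have : om = fun t x => curlCLM (fderiv ℝ (u t) x) := by funext t x; rfl
    rw [this]
    exact (hsm.fderiv_slice hU).clm_comp curlCLM
  set Pv : EuclideanSpace ℝ (Fin 3) →L[ℝ] EuclideanSpace ℝ (Fin 3) :=
    (innerSL ℝ e3).smulRight e3 with hPv
  have hPv_apply : ∀ y : EuclideanSpace ℝ (Fin 3), Pv y = ⟪e3, y⟫ • e3 := fun y => by
    rw [hPv, ContinuousLinearMap.smulRight_apply, innerSL_apply_apply]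
  set w : ℝ → EuclideanSpace ℝ (Fin 3) → EuclideanSpace ℝ (Fin 3) :=
    fun t x => ⟪e3, om t x⟫ • e3 with hwdef
  have hw_sm : FluidPDE.IsSmoothSpaceTimeOn (Icc 0 T) w := by
    have hL : FluidPDE.IsSmoothSpaceTimeOn (Icc 0 T)
        (fun (_ : ℝ) (_ : EuclideanSpace ℝ (Fin 3)) => Pv) := contDiffOn_const
    have h : FluidPDE.IsSmoothSpaceTimeOn (Icc 0 T) (fun t x => Pv (om t x)) := hL.clm_apply hom_sm
    refine ContDiffOn.congr h fun z _ => ?_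
    show w z.1 z.2 = Pv (om z.1 z.2)
    rw [hPv_apply]
  -- `∂ₜ ω = curl ∂ₜu` and the time derivative of `w`
  have hWom : ∀ t ∈ Icc 0 T, ∀ x, FluidPDE.timeDerivWithin (Icc 0 T) om t x = curl (W t) x := by
    intro t ht x
    have h := hsm.timeDerivWithin_vorticity_eq hU hcl ht
    have hom' : om = vorticity u := by funext s y; rfl
    rw [hom', h]
  have hWw : ∀ t ∈ Icc 0 T, ∀ x,
      FluidPDE.timeDerivWithin (Icc 0 T) w t x = ⟪e3, curl (W t) x⟫ • e3 := by
    intro t ht x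
    have hd := hom_sm.hasDerivWithinAt_timeDerivWithin hU ht x
    have h2 := Pv.hasFDerivAt.comp_hasDerivWithinAt t hd
    have h3 : HasDerivWithinAt (fun s => w s x)
        (⟪e3, FluidPDE.timeDerivWithin (Icc 0 T) om t x⟫ • e3) (Icc 0 T) t := by
      rw [← hPv_apply]
      exact h2.congr_of_mem (fun s _ => by simp only [Function.comp_apply, hPv_apply, hwdef]) ht
    rw [FluidPDE.timeDerivWithin_apply, h3.derivWithin (hU t ht), hWom t ht x]
  -- pointwise and `L²` bounds on the slab
  have hutC : ∀ t ∈ Icc 0 T, ContDiff ℝ ∞ (u t) := fun t ht => hsol.contDiff_velocity ht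
  have hWtC : ∀ t ∈ Icc 0 T, ContDiff ℝ ∞ (W t) := fun t ht => hWsm.contDiff_slice ht
  have hptC : ∀ t ∈ Icc 0 T, ContDiff ℝ ∞ (p t) := fun t ht => hsol.contDiff_pressure ht
  obtain ⟨B₀, hB₀⟩ := linfty_bound_of_hasBoundedSobolevNormsOn_holds
    (fun t ht => (hutC t ht).of_le (by norm_cast)) hu
  obtain ⟨B₁, -, hB₁⟩ := exists_forall_norm_fderiv_le_of_hasBoundedSobolevNormsOn
    (fun t ht => (hutC t ht).of_le (by norm_cast)) hu
  obtain ⟨B₂, hB₂⟩ := exists_forall_norm_iteratedFDeriv_le_of_hasBoundedSobolevNormsOn hutC hu 2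
  obtain ⟨C₀, hC₀⟩ := hu 0
  obtain ⟨C₁, hC₁⟩ := hu 1
  obtain ⟨C₂, hC₂⟩ := hu 2
  obtain ⟨C₃, hC₃⟩ := hu 3
  obtain ⟨E₀, hE₀⟩ := hut 0
  obtain ⟨E₁, hE₁⟩ := hut 1
  obtain ⟨P₀, hP₀⟩ := hp 0
  obtain ⟨P₁, hP₁⟩ := hp 1
  have hzero : ∀ {X : Type} [NormedAddCommGroup X] [NormedSpace ℝ X]
      {f : EuclideanSpace ℝ (Fin 3) → X} {C' : ℝ≥0},
      (∫⁻ x, ‖iteratedFDeriv ℝ 0 f x‖ₑ ^ 2 ≤ C') → ∫⁻ x, ‖f x‖ₑ ^ 2 ≤ C' := by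
    intro X _ _ f C' h
    refine (le_of_eq (lintegral_congr fun x => ?_)).trans h
    rw [← ofReal_norm, ← ofReal_norm, norm_iteratedFDeriv_zero]
  have hlt : ∀ {X : Type} [NormedAddCommGroup X] {f : EuclideanSpace ℝ (Fin 3) → X} {C' : ℝ≥0},
      (∫⁻ x, ‖f x‖ₑ ^ 2 ≤ C') → ∫⁻ x, ‖f x‖ₑ ^ 2 < ⊤ := fun h => h.trans_lt ENNReal.coe_lt_top
  set κ : ℝ := ‖(curlCLM : ((EuclideanSpace ℝ (Fin 3)) →L[ℝ] (EuclideanSpace ℝ (Fin 3))) →L[ℝ]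
    (EuclideanSpace ℝ (Fin 3)))‖ with hκ
  have hκ0 : 0 ≤ κ := norm_nonneg (curlCLM : ((EuclideanSpace ℝ (Fin 3)) →L[ℝ]
    (EuclideanSpace ℝ (Fin 3))) →L[ℝ] (EuclideanSpace ℝ (Fin 3)))
  -- bounds for `w` and `∂ₜ w`
  have n_w : ∀ t x, ‖w t x‖ ≤ ‖om t x‖ := fun t x => by
    simp only [hwdef, norm_smul, Real.norm_eq_abs, he1, mul_one]
    exact (abs_real_inner_le_norm _ _).trans (by rw [he1, one_mul])
  have n_om : ∀ t ∈ Icc 0 T, ∀ x, ‖om t x‖ ≤ κ * ‖iteratedFDeriv ℝ 1 (u t) x‖ := fun t _ x => by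
    rw [← norm_iteratedFDeriv_fderiv, norm_iteratedFDeriv_zero]
    exact norm_curl_le (u t) x
  have hB₀w : ∀ t ∈ Icc 0 T, ∀ x, ‖w t x‖ ≤ κ * B₁ := fun t ht x => by
    refine (n_w t x).trans ((norm_curl_le (u t) x).trans ?_)
    exact mul_le_mul_of_nonneg_left (hB₁ t ht x) hκ0
  have hw0b : ∀ t ∈ Icc 0 T, ∫⁻ x, ‖w t x‖ₑ ^ 2 ≤ ENNReal.ofReal (κ ^ 2) * C₁ := by
    intro t ht
    calc ∫⁻ x, ‖w t x‖ₑ ^ 2 ≤ ∫⁻ x, ENNReal.ofReal (κ ^ 2) * ‖iteratedFDeriv ℝ 1 (u t) x‖ₑ ^ 2 := by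
          refine lintegral_mono fun x => ?_
          have h := (n_w t x).trans (n_om t ht x)
          rw [← ofReal_norm, ← ofReal_norm, ← ENNReal.ofReal_pow (norm_nonneg _),
            ← ENNReal.ofReal_pow (norm_nonneg _), ← ENNReal.ofReal_mul (sq_nonneg _)]
          refine ENNReal.ofReal_le_ofReal ?_
          calc ‖w t x‖ ^ 2 ≤ (κ * ‖iteratedFDeriv ℝ 1 (u t) x‖) ^ 2 :=
                pow_le_pow_left₀ (norm_nonneg _) h 2
            _ = κ ^ 2 * ‖iteratedFDeriv ℝ 1 (u t) x‖ ^ 2 := by ring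
      _ = ENNReal.ofReal (κ ^ 2) * ∫⁻ x, ‖iteratedFDeriv ℝ 1 (u t) x‖ₑ ^ 2 :=
          lintegral_const_mul' _ _ ENNReal.ofReal_ne_top
      _ ≤ ENNReal.ofReal (κ ^ 2) * C₁ := by gcongr; exact hC₁ t ht
  have hwT0b : ∀ t ∈ Icc 0 T,
      ∫⁻ x, ‖FluidPDE.timeDerivWithin (Icc 0 T) w t x‖ₑ ^ 2 ≤ ENNReal.ofReal (κ ^ 2) * E₁ := by
    intro t ht
    calc ∫⁻ x, ‖FluidPDE.timeDerivWithin (Icc 0 T) w t x‖ₑ ^ 2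
        ≤ ∫⁻ x, ENNReal.ofReal (κ ^ 2) * ‖iteratedFDeriv ℝ 1 (W t) x‖ₑ ^ 2 := by
          refine lintegral_mono fun x => ?_
          have h : ‖FluidPDE.timeDerivWithin (Icc 0 T) w t x‖ ≤ κ * ‖iteratedFDeriv ℝ 1 (W t) x‖ := by
            rw [hWw t ht x, norm_smul, Real.norm_eq_abs, he1, mul_one]
            refine (abs_real_inner_le_norm _ _).trans ?_
            rw [he1, one_mul, ← norm_iteratedFDeriv_fderiv, norm_iteratedFDeriv_zero]
            exact norm_curl_le (W t) x
          rw [← ofReal_norm, ← ofReal_norm, ← ENNReal.ofReal_pow (norm_nonneg _),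
            ← ENNReal.ofReal_pow (norm_nonneg _), ← ENNReal.ofReal_mul (sq_nonneg _)]
          refine ENNReal.ofReal_le_ofReal ?_
          calc ‖FluidPDE.timeDerivWithin (Icc 0 T) w t x‖ ^ 2 ≤ (κ * ‖iteratedFDeriv ℝ 1 (W t) x‖) ^ 2 :=
                pow_le_pow_left₀ (norm_nonneg _) h 2
            _ = κ ^ 2 * ‖iteratedFDeriv ℝ 1 (W t) x‖ ^ 2 := by ring
      _ = ENNReal.ofReal (κ ^ 2) * ∫⁻ x, ‖iteratedFDeriv ℝ 1 (W t) x‖ₑ ^ 2 :=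
          lintegral_const_mul' _ _ ENNReal.ofReal_ne_top
      _ ≤ ENNReal.ofReal (κ ^ 2) * E₁ := by gcongr; exact hE₁ t ht
  -- the two balances
  obtain ⟨hφint, hEcont, hEb⟩ := hsm.enstrophy_balance hT hC₁ hE₁
  have hκC : ENNReal.ofReal (κ ^ 2) * (C₁ : ℝ≥0∞) = (((κ ^ 2).toNNReal * C₁ : ℝ≥0) : ℝ≥0∞) := by
    rw [ENNReal.coe_mul]; rfl
  have hκE : ENNReal.ofReal (κ ^ 2) * (E₁ : ℝ≥0∞) = (((κ ^ 2).toNNReal * E₁ : ℝ≥0) : ℝ≥0∞) := by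
    rw [ENNReal.coe_mul]; rfl
  have hw0b' : ∀ t ∈ Icc 0 T, ∫⁻ x, ‖w t x‖ₑ ^ 2 ≤ (((κ ^ 2).toNNReal * C₁ : ℝ≥0) : ℝ≥0∞) :=
    fun t ht => (hw0b t ht).trans_eq hκC
  have hwT0b' : ∀ t ∈ Icc 0 T, ∫⁻ x, ‖FluidPDE.timeDerivWithin (Icc 0 T) w t x‖ₑ ^ 2 ≤
      (((κ ^ 2).toNNReal * E₁ : ℝ≥0) : ℝ≥0∞) := fun t ht => (hwT0b t ht).trans_eq hκE
  obtain ⟨hRGint, hGcont, hGb⟩ := hw_sm.lTheta_balance hT (θ := 2) le_rfl hB₀w hw0b' hwT0b'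
  -- the quantities as functions of time
  obtain ⟨EF, hEF⟩ : ∃ EF : ℝ → ℝ, EF = fun t => ∫ x, FluidPDE.frobeniusNormSq (fderiv ℝ (u t) x) :=
    ⟨_, rfl⟩
  obtain ⟨φ, hφdef⟩ : ∃ φ : ℝ → ℝ, φ = fun t => ∫ x, 2 * ∑ i,
    ⟪fderiv ℝ (u t) x (EuclideanSpace.basisFun (Fin 3) ℝ i),
      fderiv ℝ (FluidPDE.timeDerivWithin (Icc 0 T) u t) x (EuclideanSpace.basisFun (Fin 3) ℝ i)⟫ :=
    ⟨_, rfl⟩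
  obtain ⟨G, hGdef⟩ : ∃ G : ℝ → ℝ, G = fun t => ∫ x, ‖w t x‖ ^ (2 : ℝ) := ⟨_, rfl⟩
  obtain ⟨RG, hRG⟩ : ∃ RG : ℝ → ℝ, RG = fun t => ∫ x, 2 * ‖w t x‖ ^ ((2 : ℝ) - 2) *
    ⟪w t x, FluidPDE.timeDerivWithin (Icc 0 T) w t x⟫ := ⟨_, rfl⟩
  have hEb' : ∀ b ∈ Ioc 0 T, EF b = EF 0 + ∫ t in (0 : ℝ)..b, φ t := by
    rw [hEF, hφdef]; exact hEb
  have hGb' : ∀ b ∈ Ioc 0 T, G b = G 0 + ∫ t in (0 : ℝ)..b, RG t := by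
    rw [hGdef, hRG]; exact hGb
  have hEcont' : ContinuousOn EF (Icc 0 T) := by rw [hEF]; exact hEcont
  have hGcont' : ContinuousOn G (Icc 0 T) := by rw [hGdef]; exact hGcont
  have hφint' : IntegrableOn φ (Ioo 0 T) volume := by rw [hφdef]; exact hφint
  have hRGint' : IntegrableOn RG (Ioo 0 T) volume := by rw [hRG]; exact hRGint
  obtain ⟨hΦ2int, hG2b⟩ := sq_eq_add_integral_ocg hGcont' hRGint' hGb'
  -- `G t = ∫ ω₃²`
  have hGeq : ∀ t, G t = ∫ x, (curl (u t) x 2) ^ 2 := by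
    intro t
    rw [hGdef]
    refine integral_congr_ae (Eventually.of_forall fun x => ?_)
    simp only [hwdef, norm_smul, he1, mul_one, Real.norm_eq_abs, Real.rpow_two, sq_abs, hinner, hom]
  obtain ⟨I, hIdef⟩ : ∃ I : ℝ → ℝ, I = fun t => 1 + EF t + G t ^ 2 := ⟨_, rfl⟩
  obtain ⟨Φ, hΦdef⟩ : ∃ Φ : ℝ → ℝ, Φ = fun t => φ t + 2 * G t * RG t := ⟨_, rfl⟩
  have hEF0 : ∀ t, 0 ≤ EF t := fun t => by
    rw [hEF]; exact integral_nonneg fun x => FluidPDE.frobeniusNormSq_nonneg _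
  have hG0 : ∀ t, 0 ≤ G t := fun t => by
    rw [hGdef]; exact integral_nonneg fun x => Real.rpow_nonneg (norm_nonneg _) _
  have hI1 : ∀ t, 1 ≤ I t := fun t => by
    have h1 := hEF0 t; have h2 := sq_nonneg (G t); rw [hIdef]; simp only; linarith
  have hI0 : ∀ t, 0 ≤ I t := fun t => zero_le_one.trans (hI1 t)
  -- interval integrability on `[0, b]`
  have toII : ∀ {f : ℝ → ℝ}, IntegrableOn f (Ioo 0 T) volume → ∀ b ∈ Ioc 0 T,
      IntervalIntegrable f volume 0 b := by
    intro f hf b hb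
    rw [intervalIntegrable_iff, uIoc_of_le hb.1.le, integrableOn_Ioc_iff_integrableOn_Ioo]
    exact hf.mono_set (Ioo_subset_Ioo le_rfl hb.2)
  have hΦint : IntegrableOn Φ (Ioo 0 T) volume := by
    rw [hΦdef]; exact hφint'.add hΦ2int
  have hIb : ∀ b ∈ Ioc 0 T, I b = I 0 + ∫ t in (0 : ℝ)..b, Φ t := by
    intro b hb
    have i1 : IntervalIntegrable φ volume 0 b := toII hφint' b hb
    have i2 : IntervalIntegrable (fun t => 2 * G t * RG t) volume 0 b := toII hΦ2int b hb
    have hsplit : ∫ t in (0 : ℝ)..b, Φ t =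
        (∫ t in (0 : ℝ)..b, φ t) + ∫ t in (0 : ℝ)..b, 2 * G t * RG t := by
      rw [hΦdef]; simp only
      rw [intervalIntegral.integral_add i1 i2]
    rw [hsplit, hIdef]; simp only
    rw [hEb' b hb, hG2b b hb]; ring
  -- uniform bound of `I` on the slab
  obtain ⟨ME, hME⟩ := IsCompact.exists_bound_of_continuousOn isCompact_Icc hEcont'
  obtain ⟨MG, hMG⟩ := IsCompact.exists_bound_of_continuousOn isCompact_Icc hGcont'
  have hIbd : ∀ t ∈ Icc 0 T, I t ≤ 1 + ME + MG ^ 2 := by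
    intro t ht
    have h1 : EF t ≤ ME := by
      have := hME t ht; rw [Real.norm_of_nonneg (hEF0 t)] at this; exact this
    have h2 : G t ≤ MG := by
      have := hMG t ht; rw [Real.norm_of_nonneg (hG0 t)] at this; exact this
    have h3 : G t ^ 2 ≤ MG ^ 2 := pow_le_pow_left₀ (hG0 t) h2 2
    rw [hIdef]; simp only; linarith
  -- the weight
  obtain ⟨Nq, hNq⟩ : ∃ Nq : ℝ → ℝ, Nq = fun t =>
    ((∫⁻ x, ENNReal.ofReal ‖fderiv ℝ (fun y => u t y 2) x‖ ^ r) ^ (1 / r)).toReal ^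
      (4 * r / (3 * r - 6)) := ⟨_, rfl⟩
  have hNq0 : ∀ t, 0 ≤ Nq t := fun t => by rw [hNq]; exact Real.rpow_nonneg ENNReal.toReal_nonneg _
  -- the slice estimate at a.e. time
  have hslice : ∀ τ ∈ Ioo 0 T,
      (∫⁻ x, ENNReal.ofReal ‖fderiv ℝ (fun y => u τ y 2) x‖ ^ r < ⊤) →
      Φ τ ≤ 2 * C * (1 + Nq τ + EF τ) * I τ := by
    intro τ hτ htr
    have hτI : τ ∈ Icc 0 T := Ioo_subset_Icc_self hτ
    have hmom : ∀ x, W τ x + FluidPDE.convect (u τ) (u τ) x = ν • (Δ (u τ)) x - gradient (p τ) x := by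
      intro x
      have h := hsol.momentum τ hτI x
      simpa [hW] using h
    have hcurlW : ∀ x, curl (W τ) x = ν • (Δ (curl (u τ))) x -
        FluidPDE.convect (u τ) (curl (u τ)) x + FluidPDE.convect (curl (u τ)) (u τ) x := by
      intro x
      have h := hsol.curl_timeDerivWithin_eq hU hτI x
      have h0 : curl ((0 : ℝ → EuclideanSpace ℝ (Fin 3) → EuclideanSpace ℝ (Fin 3)) τ) x = 0 := by
        have : ((0 : ℝ → EuclideanSpace ℝ (Fin 3) → EuclideanSpace ℝ (Fin 3)) τ) =
            fun _ => (0 : EuclideanSpace ℝ (Fin 3)) := rfl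
        rw [this, curl_eq_curlCLM]
        simp
      rw [h0, add_zero] at h
      rw [hW]
      exact h
    have hs' := hsl (u τ) (W τ) (p τ) B₀ B₁ B₂ (hutC τ hτI) ((hWtC τ hτI).of_le (by norm_cast))
      ((hptC τ hτI).of_le (by norm_cast)) hmom hcurlW (hsol.divFree τ hτI) (hB₀ τ hτI) (hB₁ τ hτI)
      (hB₂ τ hτI) (hlt (hzero (hC₀ τ hτI))) (hlt (hC₁ τ hτI)) (hlt (hC₂ τ hτI)) (hlt (hC₃ τ hτI))
      (hlt (hzero (hE₀ τ hτI))) (hlt (hE₁ τ hτI)) (hlt (hzero (hP₀ τ hτI))) (hlt (hP₁ τ hτI)) htr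
    -- `φ τ = 2 R_I`, `RG τ = 2 R_G`
    have hφτ : φ τ = 2 * ∫ x, ∑ i, ⟪fderiv ℝ (u τ) x (EuclideanSpace.basisFun (Fin 3) ℝ i),
        fderiv ℝ (W τ) x (EuclideanSpace.basisFun (Fin 3) ℝ i)⟫ := by
      rw [hφdef]; simp only
      rw [integral_const_mul]
    have hRGτ : RG τ = 2 * ∫ x, curl (u τ) x 2 * curl (W τ) x 2 := by
      rw [hRG]; simp only
      rw [← integral_const_mul]
      refine integral_congr_ae (Eventually.of_forall fun x => ?_)
      simp only
      rw [show ((2 : ℝ) - 2) = 0 by norm_num, Real.rpow_zero, mul_one, hWw τ hτI x]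
      simp only [hwdef, hom]
      rw [real_inner_smul_left, real_inner_smul_right, he22, hinner, hinner]
      ring
    have hΦτ : Φ τ = 2 * ((∫ x, ∑ i, ⟪fderiv ℝ (u τ) x (EuclideanSpace.basisFun (Fin 3) ℝ i),
        fderiv ℝ (W τ) x (EuclideanSpace.basisFun (Fin 3) ℝ i)⟫) +
        2 * (∫ x, (curl (u τ) x 2) ^ 2) * ∫ x, curl (u τ) x 2 * curl (W τ) x 2) := by
      rw [hΦdef]; simp only
      rw [hφτ, hRGτ, hGeq τ]; ring
    rw [hΦτ]
    have hI' : I τ = 1 + (∫ x, FluidPDE.frobeniusNormSq (fderiv ℝ (u τ) x)) +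
        (∫ x, (curl (u τ) x 2) ^ 2) ^ 2 := by
      rw [hIdef]; simp only; rw [hEF, hGeq τ]
    have hEF' : EF τ = ∫ x, FluidPDE.frobeniusNormSq (fderiv ℝ (u τ) x) := by rw [hEF]
    rw [hI', hEF', hNq]
    have h2 := mul_le_mul_of_nonneg_left hs' (zero_le_two (α := ℝ))
    refine h2.trans_eq ?_
    ring
  -- Grönwall in `ℝ≥0∞`
  obtain ⟨φE, hφE⟩ : ∃ φE : ℝ → ℝ≥0∞, φE = fun t => ENNReal.ofReal (I t) := ⟨_, rfl⟩
  obtain ⟨aE, haE⟩ : ∃ aE : ℝ → ℝ≥0∞, aE = fun t =>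
    ENNReal.ofReal (2 * C) * (1 + ENNReal.ofReal (Nq t) + ENNReal.ofReal (EF t)) := ⟨_, rfl⟩
  have hφEt : ∀ t, φE t = ENNReal.ofReal (I t) := fun t => by rw [hφE]
  have haEt : ∀ t, aE t = ENNReal.ofReal (2 * C) * (1 + ENNReal.ofReal (Nq t) + ENNReal.ofReal (EF t)) :=
    fun t => by rw [haE]
  have hM : ∀ t ∈ Icc 0 s, φE t ≤ ENNReal.ofReal (1 + ME + MG ^ 2) := fun t ht => by
    rw [hφEt]; exact ENNReal.ofReal_le_ofReal (hIbd t ⟨ht.1, ht.2.trans hs.2⟩)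
  have hA' : ∫⁻ t in Ioo 0 s, (1 + ENNReal.ofReal (Nq t) + ENNReal.ofReal (EF t)) ≠ ⊤ := by
    rw [hNq, hEF]; exact hA
  have haS : ∫⁻ t in Ioo 0 s, aE t ≠ ⊤ := by
    rw [haE]; simp only
    rw [lintegral_const_mul' _ _ ENNReal.ofReal_ne_top]
    exact ENNReal.mul_ne_top ENNReal.ofReal_ne_top hA'
  have h2C0 : 0 ≤ 2 * C := by positivity
  have hcmp : ∀ᵐ τ ∂volume, τ ∈ Ioo 0 s → ENNReal.ofReal (Φ τ) ≤ aE τ * φE τ := by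
    filter_upwards [hLr] with τ hτ hτs
    have hτT : τ ∈ Ioo 0 T := ⟨hτs.1, hτs.2.trans_le hs.2⟩
    have htr := hτ hτs
    calc ENNReal.ofReal (Φ τ) ≤ ENNReal.ofReal (2 * C * (1 + Nq τ + EF τ) * I τ) :=
          ENNReal.ofReal_le_ofReal (hslice τ hτT htr)
      _ = aE τ * φE τ := by
          rw [haEt, hφEt, ENNReal.ofReal_mul (mul_nonneg h2C0 (by linarith [hNq0 τ, hEF0 τ])),
            ENNReal.ofReal_mul h2C0, ENNReal.ofReal_add (by linarith [hNq0 τ]) (hEF0 τ),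
            ENNReal.ofReal_add zero_le_one (hNq0 τ), ENNReal.ofReal_one]
  have hineq : ∀ t ∈ Icc 0 s, φE t ≤ ENNReal.ofReal (I 0) + ∫⁻ τ in Ioo 0 t, aE τ * φE τ := by
    intro t ht
    rcases eq_or_lt_of_le ht.1 with h0 | ht0
    · rw [← h0]; simp [hφEt]
    have htT : t ∈ Ioc 0 T := ⟨ht0, ht.2.trans hs.2⟩
    have hΦt : IntegrableOn Φ (Ioo 0 t) volume := hΦint.mono_set (Ioo_subset_Ioo le_rfl htT.2)
    have h1 : ENNReal.ofReal (∫ τ in Ioo 0 t, Φ τ) ≤ ∫⁻ τ in Ioo 0 t, ENNReal.ofReal (Φ τ) := by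
      calc ENNReal.ofReal (∫ τ in Ioo 0 t, Φ τ) ≤ ENNReal.ofReal (∫ τ in Ioo 0 t, max (Φ τ) 0) :=
            ENNReal.ofReal_le_ofReal (integral_mono hΦt hΦt.pos_part fun τ => le_max_left _ _)
        _ = ∫⁻ τ in Ioo 0 t, ENNReal.ofReal (max (Φ τ) 0) :=
            ofReal_integral_eq_lintegral_ofReal hΦt.pos_part (Eventually.of_forall fun τ => le_max_right _ _)
        _ = ∫⁻ τ in Ioo 0 t, ENNReal.ofReal (Φ τ) := lintegral_congr fun τ => by
            rcases le_total (Φ τ) 0 with h | h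
            · rw [max_eq_right h, ENNReal.ofReal_zero, ENNReal.ofReal_of_nonpos h]
            · rw [max_eq_left h]
    have h2 : ∫⁻ τ in Ioo 0 t, ENNReal.ofReal (Φ τ) ≤ ∫⁻ τ in Ioo 0 t, aE τ * φE τ := by
      refine lintegral_mono_ae ((ae_restrict_iff' measurableSet_Ioo).2 ?_)
      filter_upwards [hcmp] with τ hτ hτt
      exact hτ ⟨hτt.1, hτt.2.trans_le ht.2⟩
    calc φE t = ENNReal.ofReal (I 0 + ∫ τ in (0 : ℝ)..t, Φ τ) := by
          rw [hφEt]; congr 1; exact hIb t htT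
      _ ≤ ENNReal.ofReal (I 0) + ENNReal.ofReal (∫ τ in (0 : ℝ)..t, Φ τ) := ENNReal.ofReal_add_le
      _ = ENNReal.ofReal (I 0) + ENNReal.ofReal (∫ τ in Ioo 0 t, Φ τ) := by
          rw [intervalIntegral.integral_of_le ht.1, integral_Ioc_eq_integral_Ioo]
      _ ≤ ENNReal.ofReal (I 0) + ∫⁻ τ in Ioo 0 t, aE τ * φE τ := by gcongr; exact h1.trans h2
  have hgron := lintegral_gronwall_le (S := s) ENNReal.ofReal_ne_top ENNReal.ofReal_ne_top hM haS hineq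
    s ⟨hs.1.le, le_rfl⟩
  -- unpack
  have hint_a : (∫⁻ τ in Ioo 0 s, aE τ).toReal =
      2 * C * (∫⁻ t in Ioo 0 s, (1 + ENNReal.ofReal (Nq t) + ENNReal.ofReal (EF t))).toReal := by
    rw [haE]; simp only
    rw [lintegral_const_mul' _ _ ENNReal.ofReal_ne_top, ENNReal.toReal_mul, ENNReal.toReal_ofReal h2C0]
  rw [hint_a] at hgron
  have hfinal : I s ≤ Real.exp (2 * C *
      (∫⁻ t in Ioo 0 s, (1 + ENNReal.ofReal (Nq t) + ENNReal.ofReal (EF t))).toReal) * I 0 := by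
    have h := hgron
    rw [hφEt] at h
    rw [← ENNReal.ofReal_mul (hI0 0)] at h
    have h' := (ENNReal.ofReal_le_ofReal_iff (mul_nonneg (hI0 0) (Real.exp_pos _).le)).1 h
    linarith [h', mul_comm (I 0) (Real.exp (2 * C *
      (∫⁻ t in Ioo 0 s, (1 + ENNReal.ofReal (Nq t) + ENNReal.ofReal (EF t))).toReal))]
  have hgoal := hfinal
  rw [hIdef, hNq, hEF] at hgoal; simp only at hgoal
  rw [hGeq s, hGeq 0] at hgoal
  exact hgoal

end Gronwall

end Literature.Analysis.FluidPDE

end
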